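import Summits.AtomisticToContinuum.BoseEinsteinCondensation.Theorems.StaticResponseBound.Negative.Basic
import HarnessLib

/-!
# `stub_modulatedMinimiserExists` (F1) needs its boundedness hypothesis: hard cores admit no
# nowhere-vanishing finite-energy state

Negative lemma (load-bearing analysis) for the stub `stub_modulatedMinimiserExists` (F1, skeleton v3
of line `uv-thomson-force-wave`, crux `BECInsertionCorrector.StaticResponseBound`, item
stmt-AtomisticToContinuum-12057), drefute gen-3.

F1 asks, for a BOUNDED admissible pair potential `w`, for a strictly positive real `C¹` periodic minimiser of
`E_w + s⟨∑cos⟩` with finite energy. The boundedness hypothesis `∃ M ≠ ⊤, ∀ r, w r ≤ M` cannot be dropped: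
`IsRepulsiveFiniteRange` admits hard cores, and against a hard core no nowhere-vanishing trial state has finite
energy at all. Concretely, for the hard wall `w = ⊤·1_{(-∞,4]}` (measurable, range `4`), `N = 2`, `L = 1`:
two points of the unit cell are at distance `≤ 4`, so the periodic interaction is `⊤` on the whole cell
(`periodicInteraction_hardWall_eq_top`), hence `periodicEnergy w Φ = ⊤` for every `Φ` with `Φ.ψ X ≠ 0`
everywhere (`periodicEnergy_hardWall_eq_top`), and the statement "F1 without boundedness" is false
(`not_modulatedMinimiserExists_without_bounded`). For the line this is harmless — S3 consumes F1 only at the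
truncations `w = min(v, n) ≤ n` — but it records that any proof of F1 must use the bound on `w`
(through `periodicEnergy w Φ ≠ ⊤` for a positive `Φ`). [folklore]
-/

noncomputable section

namespace Summit.AtomisticToContinuum.BoseEinsteinCondensation.Theorems.StaticResponseBound.Negative

open MeasureTheory
open scoped ENNReal NNReal BigOperators
open Literature.MathematicalPhysics.QuantumManyBody.BoseGas

/-- Points of the unit cell `[0,1)³` have norm at most `2` (`√3 ≤ 2`). [folklore] -/
theorem norm_le_two_of_mem_cell_one {x : Space} (hx : x ∈ cell 1) : ‖x‖ ≤ 2 := by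
  rw [EuclideanSpace.norm_eq]
  have hsum : ∑ i, ‖x i‖ ^ 2 ≤ 4 := by
    have h1 : ∀ i, ‖x i‖ ^ 2 ≤ 1 := by
      intro i
      have hi := hx i
      rw [Set.mem_Ico] at hi
      have habs : ‖x i‖ ≤ 1 := by
        rw [Real.norm_eq_abs, abs_of_nonneg hi.1]
        exact hi.2.le
      exact pow_le_one₀ (norm_nonneg _) habs
    calc ∑ i, ‖x i‖ ^ 2 ≤ ∑ _i : Fin 3, (1 : ℝ) := Finset.sum_le_sum fun i _ => h1 i
      _ = 3 := by simp
      _ ≤ 4 := by norm_num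
  calc Real.sqrt (∑ i, ‖x i‖ ^ 2) ≤ Real.sqrt 4 := Real.sqrt_le_sqrt hsum
    _ = 2 := by
      rw [show (4 : ℝ) = 2 ^ 2 by norm_num, Real.sqrt_sq (by norm_num)]

/-- Two points of the unit cell are at distance at most `4`. [folklore] -/
theorem norm_sub_le_four_of_mem_cell_one {x y : Space} (hx : x ∈ cell 1) (hy : y ∈ cell 1) :
    ‖x - y‖ ≤ 4 := by
  calc ‖x - y‖ ≤ ‖x‖ + ‖y‖ := norm_sub_le x y
    _ ≤ 2 + 2 := add_le_add (norm_le_two_of_mem_cell_one hx) (norm_le_two_of_mem_cell_one hy)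
    _ = 4 := by norm_num

/-- The hard wall `⊤·1_{(-∞,4]}` is an admissible (measurable, finite-range) pair potential. [folklore] -/
theorem isRepulsiveFiniteRange_hardWall :
    IsRepulsiveFiniteRange (fun r : ℝ => if r ≤ 4 then (⊤ : ℝ≥0∞) else 0) := by
  refine ⟨Measurable.ite measurableSet_Iic measurable_const measurable_const, 4, fun r hr => ?_⟩
  simp [not_le.mpr hr]

/-- A single pair term is below the periodic interaction (the `(0,1)` term of the pair sum and the
`n = 0` image). [folklore] -/
theorem apply_norm_sub_le_periodicInteraction_two (w : ℝ → ℝ≥0∞) (L : ℝ) (X : Config 2) :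
    w ‖X 0 - X 1‖ ≤ periodicInteraction w L X := by
  classical
  refine (le_periodizedPotential w L (X 0 - X 1)).trans ?_
  unfold periodicInteraction
  refine le_trans ?_ (Finset.single_le_sum
    (f := fun i : Fin 2 => ∑ j ∈ Finset.univ.filter (fun j => i < j), periodizedPotential w L (X i - X j))
    (fun _ _ => zero_le) (Finset.mem_univ (0 : Fin 2)))
  exact Finset.single_le_sum (f := fun j : Fin 2 => periodizedPotential w L (X 0 - X j))
    (fun _ _ => zero_le) (Finset.mem_filter.2 ⟨Finset.mem_univ (1 : Fin 2), by decide⟩)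

/-- Against the hard wall of radius `4`, the periodic interaction of two particles in the unit cell is `⊤`
everywhere on the cell. [folklore] -/
theorem periodicInteraction_hardWall_eq_top {X : Config 2} (hX : X ∈ cellN 2 1) :
    periodicInteraction (fun r : ℝ => if r ≤ 4 then (⊤ : ℝ≥0∞) else 0) 1 X = ⊤ := by
  refine eq_top_iff.2 (le_trans (le_of_eq ?_) (apply_norm_sub_le_periodicInteraction_two _ 1 X))
  rw [if_pos (norm_sub_le_four_of_mem_cell_one (hX 0) (hX 1))]

/-- The two-particle unit cell is measurable. [folklore] -/
theorem measurableSet_cellN_two_one : MeasurableSet (cellN 2 (1 : ℝ)) := by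
  have : cellN 2 (1 : ℝ) = ⋂ i : Fin 2, (fun X : Config 2 => X i) ⁻¹' cell 1 := by
    ext X; simp [cellN]
  rw [this]
  exact MeasurableSet.iInter fun i => (measurableSet_cell 1).preimage (measurable_pi_apply i)

/-- **Hard cores admit no nowhere-vanishing finite-energy state**: against the hard wall, every
two-particle periodic trial state on the unit cell with `Φ.ψ X ≠ 0` everywhere has energy `⊤`. [folklore] -/
theorem periodicEnergy_hardWall_eq_top (Φ : PeriodicTrialState 2 1) (hpos : ∀ X, Φ.ψ X ≠ 0) :
    periodicEnergy (fun r : ℝ => if r ≤ 4 then (⊤ : ℝ≥0∞) else 0) Φ = ⊤ := by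
  refine eq_top_iff.2 ?_
  have hvol : volume (cellN 2 (1 : ℝ)) = 1 := by
    rw [volume_cellN]; simp
  have hconst : ∫⁻ _ in cellN 2 (1 : ℝ), (⊤ : ℝ≥0∞) = ⊤ := by
    rw [setLIntegral_const, hvol, mul_one]
  unfold periodicEnergy
  refine hconst.symm.trans_le (setLIntegral_mono' measurableSet_cellN_two_one fun X hX => ?_)
  have hne : ((‖Φ.ψ X‖₊ : ℝ≥0∞)) ^ 2 ≠ 0 :=
    pow_ne_zero 2 (ENNReal.coe_ne_zero.2 (nnnorm_ne_zero_iff.2 (hpos X)))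
  rw [periodicInteraction_hardWall_eq_top hX, ENNReal.top_mul hne, add_top]

/-- **F1 without boundedness is false.** Dropping `∃ M ≠ ⊤, ∀ r, w r ≤ M` from the registered stub
`stub_modulatedMinimiserExists` gives a false statement: at the hard wall, `N = 2`, `L = 1`, `k = (1,1,1)`,
`s = 0`, no positive state has finite energy, let alone a positive minimiser. Hence any proof of F1 must use
the bound on `w`. [folklore] -/
theorem not_modulatedMinimiserExists_without_bounded :
    ¬ (∀ w : ℝ → ℝ≥0∞, IsRepulsiveFiniteRange w →
        ∀ (N : ℕ), 1 ≤ N → ∀ (L : ℝ), 0 < L → ∀ (k : Fin 3 → ℤ), k ≠ 0 → ∀ s : ℝ,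
        ∃ Φ : PeriodicTrialState N L, (∀ X, Φ.ψ X = (‖Φ.ψ X‖ : ℂ)) ∧ (∀ X, Φ.ψ X ≠ 0) ∧
          periodicEnergy w Φ ≠ ⊤ ∧
          ∀ Ψ : PeriodicTrialState N L, periodicEnergy w Ψ ≠ ⊤ →
            (periodicEnergy w Φ).toReal + s * cosMean L k Φ ≤
              (periodicEnergy w Ψ).toReal + s * cosMean L k Ψ) := by
  intro h
  have hk : (fun _ : Fin 3 => (1 : ℤ)) ≠ 0 := fun h0 => by simpa using congr_fun h0 0
  obtain ⟨Φ, -, hpos, hfin, -⟩ :=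
    h _ isRepulsiveFiniteRange_hardWall 2 (by norm_num) 1 one_pos _ hk 0
  exact hfin (periodicEnergy_hardWall_eq_top Φ hpos)

end Summit.AtomisticToContinuum.BoseEinsteinCondensation.Theorems.StaticResponseBound.Negative

end
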